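import Summits.BirchSwinnertonDyer.BirchSwinnertonDyer.Theorems.GenusKolyvaginAtTwoGenusPrimitiveSupplyAtTwoPosDiscShallowKFourPosHalvingDescent
import Summits.BirchSwinnertonDyer.BirchSwinnertonDyer.Theorems.GenusKolyvaginAtTwoShaCardDvdPowAtTwoRSelVisibleHabitat
import HarnessLib

/-!
# Route `GenusKolyvaginAtTwo`, cruxes K₄⁺ `K4Pos` (31469) / K₄⁻ `K4Neg` (31526) — THE HALVING DESCENT B2Q♭ WITHOUT (NPh_K)

LEAD seat `bsd-line-gk2-p1` g28, `--supports stmt-BirchSwinnertonDyer-31526 --as helper`.  THEOREMS ONLY; no `sorry`.  **BSD is NOT proved here;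
K4Pos / K4Neg are NOT proved; nothing is closed.**  LINES 33/34 v1.5 localise the remaining content of K₄ (mod WALL row 1, U₂, Q2, PRINT) to the
cell F4ᵖᵍ, where the master descent's hypothesis (NPh_K) («no non-zero everywhere-locally-Kummer phantom in `H¹(K, E[2^L])`») is FALSE (the
Lawson–Wuthrich class `ξ_E ∈ Ш(E/ℚ)[2]`).  The landed master proof uses (NPh_K) ONCE: to separate the pair (`res s₀`, `c_M(1)`) for the regular
pair-Čebotarev supply.  By Lawson–Wuthrich OVER `K` on the habitat a phantom is `2`-torsion and `τ`-fixed; the pair has `τ`-signs `(+1, −1)`; so the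
separation reduces to `hSep`: «no `2`-torsion combination `a•ι(res s₀) + b•ι(c_M(1))` is a non-zero phantom» — a condition on the three TOP BITS
`S'`, `Y'`, `S'+Y'` only.  The theorem below is the landed proof VERBATIM except for that derivation (and the two non-square side conditions it needs).
References: [McCallumLMS1991] §5; [Kolyvagin1989Izv] Thm. B₂; [GrossLMS1991] §4, Prop. 6.2; [LawsonWuthrich2016] §7.1, Lemma 3.
-/

set_option autoImplicit false
-- the Theorems namespace of this sub repeats the summit name by design (D-0017 nested layout)
set_option linter.dupNamespace false

noncomputable section

open scoped Classical AddSubgroup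

namespace Summit.BirchSwinnertonDyer.BirchSwinnertonDyer.Theorems.GenusExact.PlusDescent

open WeierstrassCurve NumberField IsDedekindDomain Field Rat.HeightOneSpectrum Literature.NumberTheory.EllipticCurves
  Literature.NumberTheory.GaloisRepresentations Literature.NumberTheory.EllipticCurves.ModularForms AddSubgroup
  Literature.NumberTheory.EllipticCurves.RingClassField
open Literature.NumberTheory.EllipticCurves.KolyvaginCocycle
open Summit.BirchSwinnertonDyer.BirchSwinnertonDyer.Theses.GenusKolyvaginAtTwo (KolyvaginRelationAtTwo)
open Summit.BirchSwinnertonDyer.Rank1Residual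
open Summit.BirchSwinnertonDyer.BirchSwinnertonDyer.Theorems.GenusExact
open Summit.BirchSwinnertonDyer.BirchSwinnertonDyer.Theorems.GenusExact.VisiblePairAtTwo
  (liesOver_of_natCast_mem natCast_mem_primesEquiv_symm natCast_prime_mem_iff_eq hasGoodReductionAt_of_hasGoodReductionAtPrime
    not_mem_range intCast_notMem_of_not_dvd)
open Summit.BirchSwinnertonDyer.BirchSwinnertonDyer.Theorems.OffBigImageOddLocalAtTwo

set_option maxHeartbeats 800000 in -- one long elaboration: the B₂ descent (≈ 200k alone) + the half-point descent at three levels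
/-- **B2Q♭ with (NPh_K) replaced by the top-bit pair separation `hSep`** (modulo Q2 and the regular pair-Čebotarev supply `hPair`): frame of
the landed `…_of_nonPhantom_of_regularPairSupply` plus `hsq1`, `hsq2`; `hSep` says that at level `2^(M+2)` a phantom of the form
`a • ι(res s₀) + b • ι(c_M(1))` with both summands `2`-torsion is `0`.  **If `s₀ ∈ Sel_(2^M)(E/ℚ)`, `M ≥ M₀ + 1`, has `2^{M₀−1} • s₀ ≠ 0` and
satisfies `hSep`, there are a transposition-deep Kolyvagin prime `ℓ` of index `≥ M + 2` and a compatible datum of conductor `1·ℓ` with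
`P(1·ℓ) ∉ 2E(K[1·ℓ])`.**  `hres` is derived from `hSep` by `VisiblePairAtTwo.two_zsmul_eq_zero_of_forall_h1Eval_eq_zero_habitat` /
`…conjAct_eq_self_of_forall_h1Eval_eq_zero_habitat` and the signs; everything else is VERBATIM.  BSD is NOT proved by this.
[cite: McCallumLMS1991, §5 Lemma 5.3, Thm. 5.4] [cite: Kolyvagin1989Izv, Thm. B₂] [cite: LawsonWuthrich2016, §7.1 and Lemma 3] -/
theorem exists_transpositionDeep_primitive_of_two_pow_pred_smul_ne_zero_of_pairSeparation_of_regularPairSupply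
    (hQ2 : KolyvaginRelationAtTwo)
    (W : WeierstrassCurve ℚ) [W.IsElliptic] [W.IsGloballyMinimal] [NeZero (W.conductorNorm ℤ)] (hcm : ¬ W.HasCM)
    (hT : Odd W.tamagawaProduct)
    (K : Type) [Field K] [NumberField K] (hIQ : IsImaginaryQuadratic K) (hodd : Odd (NumberField.discr K))
    (h3 : NumberField.discr K ≠ -3) (hHe : SatisfiesHeegnerHypothesis (W.conductorNorm ℤ) K)
    (hρ : ∀ n : ℕ, 0 < n → W.HasSurjectiveModNGaloisRep ((2 : ℤ) ^ n))
    (hsq1 : ¬ IsSquare ((NumberField.discr K : ℚ) * -|W.Δ|)) (hsq2 : ¬ IsSquare ((NumberField.discr K : ℚ) * (-(2 * |W.Δ|))))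
    (Dt : ModularParametrizationData W (W.conductorNorm ℤ)) (β : ℤ) (ι : K →+* ℂ) (d₁ : KolyvaginHeegnerData Dt β ι 1) (M₀ : ℕ)
    (hndiv : ¬ ∃ Q : (W.baseChange (ringClassField K ι 1)).toAffine.Point, ((2 ^ (M₀ + 1) : ℕ) : ℤ) • Q = d₁.derivedPoint)
    (hw1 : W.rootNumber = 1)
    (hPair : ∀ (n : ℕ) (c : K ≃ₐ[ℚ] K), c ≠ 1 →
      ∀ (x y : galH1Torsion (W.baseChange K) ((2 ^ (n + 1) : ℕ) : ℤ)) (ex ey : ℕ), 1 ≤ ex → 1 ≤ ey →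
      addOrderOf x = 2 ^ ex → addOrderOf y = 2 ^ ey →
      ∀ (sx sy : ℤ), (sx = 1 ∨ sx = -1) → (sy = 1 ∨ sy = -1) →
      conjAct W c ((2 ^ (n + 1) : ℕ) : ℤ) x = sx • x → conjAct W c ((2 ^ (n + 1) : ℕ) : ℤ) y = sy • y →
      (∀ a b : ℤ, (∀ ρ ∈ torsionFixing (W.baseChange K) ((2 ^ (n + 1) : ℕ) : ℤ),
          h1Eval (W.baseChange K) ((2 ^ (n + 1) : ℕ) : ℤ) (a • x + b • y) ρ = 0) → a • x + b • y = 0) →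
      ∃ ℓ : ℕ, Zhang2014.IsKolyvaginPrime (W.conductorNorm ℤ) W K 2 ℓ ∧ n + 1 ≤ Zhang2014.kolyvaginIndex W 2 ℓ ∧
        (∃ (v : HeightOneSpectrum (𝓞 ℚ)) (𝔓 : Ideal (absIntegers (𝓞 ℚ) ℚ)) (h c₀ : absoluteGaloisGroup ℚ),
          (ℓ : 𝓞 ℚ) ∈ v.asIdeal ∧ 𝔓 ∈ v.primesAbove ∧ IsArithFrobAt (𝓞 ℚ) h 𝔓 ∧ IsComplexConjugation (Rat.castHom ℝ) c₀ ∧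
          (∀ X : geomTorsion W ((2 ^ (n + 1) : ℕ) : ℤ), h • h • X = X) ∧
          (∃ u : geomTorsion W ((2 : ℕ) : ℤ), h • u ≠ u) ∧
          ∀ (e : K →ₐ[ℚ] AlgebraicClosure ℚ) (z : K), h • e z = c₀ • e z) ∧
        ∀ w : HeightOneSpectrum (𝓞 K), (ℓ : 𝓞 K) ∈ w.asIdeal →
          (∀ j : ℕ, ((2 ^ j : ℕ) : ℤ) • x ∈ (W.baseChange K).torsionLocalKer (w.adicCompletion K) ((2 ^ (n + 1) : ℕ) : ℤ) ↔ ex ≤ j) ∧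
          (∀ j : ℕ, ((2 ^ j : ℕ) : ℤ) • y ∈ (W.baseChange K).torsionLocalKer (w.adicCompletion K) ((2 ^ (n + 1) : ℕ) : ℤ) ↔ ey ≤ j))
    (M : ℕ) (hM₀M : M₀ + 1 ≤ M) (s₀ : galH1Torsion W ((2 ^ M : ℕ) : ℤ)) (hs₀ : s₀ ∈ selmerGroup W ((2 ^ M : ℕ) : ℤ))
    (hne : ((2 ^ (M₀ - 1) : ℕ) : ℤ) • s₀ ≠ 0)
    (hSep : ∀ (hd : ((2 ^ M : ℕ) : ℤ) ∣ ((2 ^ (M + 2) : ℕ) : ℤ)) (a b : ℤ),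
      (2 : ℤ) • (a • torsionH1OfDvd (W.baseChange K) hd (resTorsion W K ((2 ^ M : ℕ) : ℤ) s₀)) = 0 →
      (2 : ℤ) • (b • torsionH1OfDvd (W.baseChange K) hd (d₁.kolyvaginClass Nat.prime_two M)) = 0 →
      (∀ ρ' ∈ torsionFixing (W.baseChange K) ((2 ^ (M + 2) : ℕ) : ℤ),
        h1Eval (W.baseChange K) ((2 ^ (M + 2) : ℕ) : ℤ)
          (a • torsionH1OfDvd (W.baseChange K) hd (resTorsion W K ((2 ^ M : ℕ) : ℤ) s₀) +
            b • torsionH1OfDvd (W.baseChange K) hd (d₁.kolyvaginClass Nat.prime_two M)) ρ' = 0) →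
      a • torsionH1OfDvd (W.baseChange K) hd (resTorsion W K ((2 ^ M : ℕ) : ℤ) s₀) +
        b • torsionH1OfDvd (W.baseChange K) hd (d₁.kolyvaginClass Nat.prime_two M) = 0) :
    ∃ (ℓ : ℕ) (d : KolyvaginHeegnerData Dt β ι (1 * ℓ)),
      Zhang2014.IsKolyvaginPrime (W.conductorNorm ℤ) W K 2 ℓ ∧ M + 2 ≤ Zhang2014.kolyvaginIndex W 2 ℓ ∧
      (∃ (v : HeightOneSpectrum (𝓞 ℚ)) (𝔓 : Ideal (absIntegers (𝓞 ℚ) ℚ)) (h c₀ : absoluteGaloisGroup ℚ),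
          (ℓ : 𝓞 ℚ) ∈ v.asIdeal ∧ 𝔓 ∈ v.primesAbove ∧ IsArithFrobAt (𝓞 ℚ) h 𝔓 ∧ IsComplexConjugation (Rat.castHom ℝ) c₀ ∧
          (∀ X : geomTorsion W ((2 ^ (M + 2) : ℕ) : ℤ), h • h • X = X) ∧
          (∃ u : geomTorsion W ((2 : ℕ) : ℤ), h • u ≠ u) ∧
          ∀ (e : K →ₐ[ℚ] AlgebraicClosure ℚ) (z : K), h • e z = c₀ • e z) ∧
      (∀ s ∈ d₁.S, ∃ s' ∈ d.S, ∀ (x : ringClassField K ι 1) (x' : ringClassField K ι (1 * ℓ)),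
          (x : ℂ) = x' → ((s' x' : ringClassField K ι (1 * ℓ)) : ℂ) = (s x : ℂ)) ∧
      (∀ (x : ringClassField K ι 1) (x' : ringClassField K ι (1 * ℓ)), (x : ℂ) = x' → d.emb x' = d₁.emb x) ∧
      ¬ ∃ Q : (W.baseChange (ringClassField K ι (1 * ℓ))).toAffine.Point, (2 : ℤ) • Q = d.derivedPoint := by
  haveI : Fact (Nat.Prime 2) := ⟨Nat.prime_two⟩
  haveI : ∀ j : ℕ, NumberField (ringClassField K ι j) := JET.numberField_ringClassField K hIQ ι
  haveI hell : (W.baseChange K).IsElliptic := inferInstanceAs ((W.map (algebraMap ℚ K)).IsElliptic)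
  have hM : 1 ≤ M := le_trans (Nat.le_add_left 1 M₀) hM₀M
  have hM' : 1 ≤ M + 1 := by omega
  have hM'' : 1 ≤ M + 1 + 1 := by omega
  -- ### numerics and currencies
  have hsurN : ∀ m : ℕ, W.HasSurjectiveModNGaloisRep ((2 ^ m : ℕ) : ℤ) := MinimalTwinBSDTwo.forall_hasSurjectiveModNGaloisRep_two_pow_of_pos W hρ
  have hρN : ∀ m : ℕ, W.HasSurjectiveModNGaloisRep (2 ^ m : ℕ) := fun m ↦ by exact_mod_cast hsurN m
  have hsurj1 : W.HasSurjectiveModNGaloisRep ((2 : ℤ) ^ 1) := hρ 1 one_pos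
  have hs2 : W.HasSurjectiveModNGaloisRep 2 := by simpa using hsurj1
  have h2 : Module.finrank ℚ K = 2 := hIQ.1
  have hD4 : NumberField.discr K ≠ -4 := fun h ↦ by
    rw [h] at hodd; exact (Int.not_even_iff_odd.mpr hodd) ⟨-2, by norm_num⟩
  have hD : NumberField.discr K < -4 := X11b.KolyvaginAssembly.discr_lt_neg_four hIQ ⟨h3, hD4⟩
  -- the complex conjugation `τ = σ_θ`, `θ² = d_K`
  obtain ⟨θ, hθ, hd⟩ := Literature.NumberTheory.QuadraticFields.Quadratic.exists_not_mem_range_sq_eq_discr (K := K) h2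
  set τ : K ≃ₐ[ℚ] K := sigmaQ K h2 hθ hd with hτdef
  have hτ : τ ≠ 1 := sigmaQ_ne_one K h2 hθ hd
  -- ### no `2`-power torsion in `E(K)`
  have htorsK : ∀ (m : ℕ) (P : (W.baseChange K).toAffine.Point), ((2 ^ m : ℕ) : ℤ) • P = 0 → P = 0 := fun m P hP ↦
    EigenClassesFinite.forall_zsmul_two_pow_baseChange_eq_zero_of_hasSurjectiveModNGaloisRep_two W K h2 hs2 m P
      (by exact_mod_cast hP)
  have hbotK : AddSubgroup.torsionBy (W.baseChange K).toAffine.Point ((2 : ℕ) : ℤ) = ⊥ := by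
    rw [eq_bot_iff]
    intro P hP
    rw [AddSubgroup.mem_bot]
    exact htorsK 1 P (by simpa using hP)
  -- ### the Selmer class over `K`: `s = res s₀`, `τ`-invariant, same order `2^a`
  set s := resTorsion W K ((2 ^ M : ℕ) : ℤ) s₀ with hsdef
  have hsSel : s ∈ selmerGroup (W.baseChange K) ((2 ^ M : ℕ) : ℤ) := resTorsion_mem_selmerGroup W K ((2 ^ M : ℕ) : ℤ) hs₀
  have hinjres : Function.Injective (resTorsion W K ((2 ^ M : ℕ) : ℤ)) :=
    EigenClassesFinite.resTorsion_injective_of_noTorsion W K h2 hθ hd ((2 ^ M : ℕ) : ℤ) (htorsK M)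
  have hinjres1 : Function.Injective (resTorsion W K ((2 ^ (M + 1) : ℕ) : ℤ)) :=
    EigenClassesFinite.resTorsion_injective_of_noTorsion W K h2 hθ hd ((2 ^ (M + 1) : ℕ) : ℤ) (htorsK (M + 1))
  have hτs : conjAct W τ ((2 ^ M : ℕ) : ℤ) s = s :=
    (EigenClassesFinite.mem_range_resTorsion_iff_conjAct_eq W K h2 hθ hd ((2 ^ M : ℕ) : ℤ) (htorsK M) s).mp ⟨s₀, rfl⟩
  obtain ⟨a, haM, ha⟩ := exists_addOrderOf_galH1Torsion_eq_two_pow W K M s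
  by_cases ha0 : a = 0
  · -- `s = 0`, hence `s₀ = 0`: contradicts `hne`
    have hs0 : s = 0 := AddMonoid.addOrderOf_eq_one_iff.mp (by rw [ha, ha0, pow_zero])
    have : s₀ = 0 := hinjres (by rw [← hsdef, hs0, map_zero])
    exact (hne (by rw [this, zsmul_zero])).elim
  have ha1 : 1 ≤ a := Nat.one_le_iff_ne_zero.mpr ha0
  -- ### the Heegner class `y = c_M(1) = δ Ph`, order `2^κ`, `κ ≥ M − M₀`, sign `−1`
  have hdiv : ∀ P : geomPoints (W.baseChange K), ∃ Q : geomPoints (W.baseChange K), ((2 ^ M : ℕ) : ℤ) • Q = P :=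
    (W.baseChange K).zsmul_geomPoints_surjective_of_charZero (by positivity)
  set δ := kummerMapTorsion (W.baseChange K) ((2 ^ M : ℕ) : ℤ) hdiv with hδ
  have hker : δ.ker = (zsmulAddGroupHom (α := (W.baseChange K).toAffine.Point) ((2 ^ M : ℕ) : ℤ)).range :=
    kummerMapTorsion_ker (W.baseChange K) ((2 ^ M : ℕ) : ℤ) hdiv
  obtain ⟨Ph, hPh, hPhmap⟩ := AdditiveKoly.exists_isHeegnerPoint_map_eq_derivedPoint_one (W := W) (K := K) (Dt := Dt) (β := β)
    (ι := ι) hIQ hHe d₁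
  set y := d₁.kolyvaginClass Nat.prime_two M with hydef
  have hc1 : y = δ Ph := VisiblePairAtTwo.kolyvaginClass_one_two_eq_kummerMapTorsion W K hIQ hodd hHe hsurj1 M d₁ Ph hPhmap
  have hP₀ : ∀ Q : (W.baseChange K).toAffine.Point, ((2 ^ (M₀ + 1) : ℕ) : ℤ) • Q ≠ Ph :=
    forall_two_pow_smul_ne_bottom_of_not_dvd_derivedPoint d₁ Ph hPhmap le_rfl hndiv
  obtain ⟨κ, hκM, hκ⟩ := exists_addOrderOf_galH1Torsion_eq_two_pow W K M y
  have hκge : M - M₀ ≤ κ := by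
    by_contra hlt'
    have h0 : ((2 ^ κ : ℕ) : ℤ) • y = 0 := (two_pow_zsmul_eq_zero_iff_of_addOrderOf W K hκ κ).mpr le_rfl
    have hmem : ((2 ^ κ : ℕ) : ℤ) • Ph ∈ δ.ker := by rw [AddMonoidHom.mem_ker, map_zsmul, ← hc1, h0]
    rw [hker] at hmem
    obtain ⟨R, hR⟩ := hmem
    have hPhR : Ph = ((2 ^ (M - κ) : ℕ) : ℤ) • R := eq_two_pow_zsmul_of_two_pow_zsmul_eq (htorsK 1 · <| by simpa using ·) hκM hR
    refine hP₀ (((2 ^ (M - κ - (M₀ + 1)) : ℕ) : ℤ) • R) ?_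
    rw [hPhR, smul_smul]
    congr 1
    push_cast
    rw [← pow_add]
    congr 1
    omega
  have hκ1 : 1 ≤ κ := by omega
  have h1K : ∀ q ∈ (1 : ℕ).primeFactors, Zhang2014.IsKolyvaginPrime (W.conductorNorm ℤ) W K 2 q ∧ M ≤ Zhang2014.kolyvaginIndex W 2 q := by
    simp
  obtain ⟨-, hτy⟩ := KolyvaginClassSign.sign_conjAct_kolyvaginClass_two hIQ h3 hD4 hodd hHe hsurj1 τ hτ Dt β ι squarefree_one hM h1K d₁
  rw [Nat.primeFactors_one, Finset.card_empty, pow_zero, mul_one, hw1] at hτy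
  -- ### the one-step change of level `ι_M : H¹(K, E[2^M]) → H¹(K, E[2^(M+1)])` (used for the half-point class)
  have hdvd : ((2 ^ M : ℕ) : ℤ) ∣ ((2 ^ (M + 1) : ℕ) : ℤ) := KolyvaginPairDataTwo.two_pow_dvd_two_pow_succ M
  set ιM := torsionH1OfDvd (W.baseChange K) hdvd with hιM
  have hιinj : Function.Injective ιM := KolyvaginPairDataTwo.torsionH1OfDvd_succ_injective W M hIQ hs2
  -- ### TWO LEVELS UP: `ι₂ s`, `ι₂ y` at level `2^(M+2)` (the regular prime is requested with index `≥ M + 2`)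
  have hdvd2 : ((2 ^ M : ℕ) : ℤ) ∣ ((2 ^ (M + 2) : ℕ) : ℤ) := natCast_pow_dvd_natCast_pow (p := 2) (by omega)
  set ι₂ := torsionH1OfDvd (W.baseChange K) hdvd2 with hι₂
  have hι₂inj : Function.Injective ι₂ := VisiblePairAtTwo.torsionH1OfDvd_pow_injective (W.baseChange K) (p := 2) hbotK hdvd2
  have hsSel' : ι₂ s ∈ selmerGroup (W.baseChange K) ((2 ^ (M + 2) : ℕ) : ℤ) := torsionH1OfDvd_mem_selmerGroup (W.baseChange K) hdvd2 hsSel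
  have hySel : y ∈ selmerGroup (W.baseChange K) ((2 ^ M : ℕ) : ℤ) := by
    rw [hc1]; exact WeierstrassCurve.kummerMapTorsion_mem_selmerGroup (W.baseChange K) _ hdiv Ph
  have hySel' : ι₂ y ∈ selmerGroup (W.baseChange K) ((2 ^ (M + 2) : ℕ) : ℤ) := torsionH1OfDvd_mem_selmerGroup (W.baseChange K) hdvd2 hySel
  have hords' : addOrderOf (ι₂ s) = 2 ^ a := by rw [addOrderOf_injective ι₂ hι₂inj, ha]
  have hordy' : addOrderOf (ι₂ y) = 2 ^ κ := by rw [addOrderOf_injective ι₂ hι₂inj, hκ]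
  have hτs' : conjAct W τ ((2 ^ (M + 2) : ℕ) : ℤ) (ι₂ s) = (1 : ℤ) • ι₂ s := by
    rw [one_zsmul, hι₂, conjAct_torsionH1OfDvd W τ hdvd2 s, hτs]
  have hτy' : conjAct W τ ((2 ^ (M + 2) : ℕ) : ℤ) (ι₂ y) = (-1 : ℤ) • ι₂ y := by
    rw [hι₂, conjAct_torsionH1OfDvd W τ hdvd2 y, hτy, map_zsmul]
  -- separation for the pair from `hSep`: a phantom `φ` has `2φ = 0`, `τφ = φ` (LW over `K`), and `τφ = a'•ι₂ s − b'•ι₂ y`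
  have hres : ∀ a' b' : ℤ, (∀ ρ' ∈ torsionFixing (W.baseChange K) ((2 ^ (M + 2) : ℕ) : ℤ),
      h1Eval (W.baseChange K) ((2 ^ (M + 2) : ℕ) : ℤ) (a' • ι₂ s + b' • ι₂ y) ρ' = 0) → a' • ι₂ s + b' • ι₂ y = 0 := by
    intro a' b' hab
    have hab' := fun ρ' : torsionFixing (W.baseChange K) ((2 ^ (M + 2) : ℕ) : ℤ) ↦ hab ρ'.1 ρ'.2
    have h2φ : (2 : ℤ) • (a' • ι₂ s + b' • ι₂ y) = 0 :=
      VisiblePairAtTwo.two_zsmul_eq_zero_of_forall_h1Eval_eq_zero_habitat W K (M + 2) hIQ hodd hsq1 hsq2 hρ _ hab'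
    have hτφ : conjAct W τ ((2 ^ (M + 2) : ℕ) : ℤ) (a' • ι₂ s + b' • ι₂ y) = a' • ι₂ s + b' • ι₂ y :=
      VisiblePairAtTwo.conjAct_eq_self_of_forall_h1Eval_eq_zero_habitat W K (M + 2) hIQ hθ hd hodd hsq1 hsq2 hρ (by omega) _ hab'
    have hτφ' : conjAct W τ ((2 ^ (M + 2) : ℕ) : ℤ) (a' • ι₂ s + b' • ι₂ y) = a' • ι₂ s + -(b' • ι₂ y) := by
      rw [map_add, map_zsmul, map_zsmul, hτs', hτy', one_zsmul, neg_one_zsmul, zsmul_neg]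
    have hbb : -(b' • ι₂ y) = b' • ι₂ y := add_left_cancel (hτφ'.symm.trans hτφ)
    have h2bY : (2 : ℤ) • (b' • ι₂ y) = 0 := by rw [two_zsmul]; nth_rewrite 1 [← hbb]; exact neg_add_cancel _
    have h2aS : (2 : ℤ) • (a' • ι₂ s) = 0 := by rwa [zsmul_add, h2bY, add_zero] at h2φ
    exact hSep hdvd2 a' b' h2aS h2bY hab
  -- ### the REGULAR Kolyvagin prime from the displayed supply `hPair` (level `2^(M+2)`, signs `(+1, −1)`)
  obtain ⟨ℓ, hkolZ, hidx', hfrob, hloc'⟩ := hPair (M + 1) τ hτ (ι₂ s) (ι₂ y) a κ ha1 hκ1 hords' hordy' 1 (-1) (Or.inl rfl)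
    (Or.inr rfl) hτs' hτy' hres
  have hidx2 : M + 2 ≤ Zhang2014.kolyvaginIndex W 2 ℓ := hidx'
  obtain ⟨hℓp, hℓN, hℓdK, hℓ2, hℓprime, hidxpos⟩ := hkolZ
  haveI : Fact ℓ.Prime := ⟨hℓp⟩
  have hkolZ : Zhang2014.IsKolyvaginPrime (W.conductorNorm ℤ) W K 2 ℓ := ⟨hℓp, hℓN, hℓdK, hℓ2, hℓprime, hidxpos⟩
  obtain ⟨vP, 𝔓, hfr, c₀, hℓvP, h𝔓, hhfr, hc₀, hhsq, hhu, hhK⟩ := hfrob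
  -- the place `λ = (ℓ)` of `K`
  set w : HeightOneSpectrum (𝓞 K) := ⟨Ideal.span {(ℓ : 𝓞 K)}, hℓprime, by
    rw [Ne, Ideal.span_singleton_eq_bot]; exact_mod_cast hℓp.ne_zero⟩ with hwdef
  have hwℓ : (ℓ : 𝓞 K) ∈ w.asIdeal := Ideal.mem_span_singleton_self _
  -- the rational place `v_ℓ` and its local data
  set vℓ : HeightOneSpectrum (𝓞 ℚ) := primesEquiv.symm ⟨ℓ, hℓp⟩ with hvℓdef
  have hℓv : (ℓ : 𝓞 ℚ) ∈ vℓ.asIdeal := natCast_mem_primesEquiv_symm hℓp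
  have hvPℓ : vP = vℓ := (natCast_prime_mem_iff_eq hℓp vP).mp hℓvP
  obtain ⟨h2vℓ, hqv⟩ := SelmerDescent.two_notMem_and_natCast_two_pow_notMem (rfl : 2 ^ M = 2 ^ M) hℓp hℓ2 hℓv
  have hdKv : ((NumberField.discr K : ℤ) : 𝓞 ℚ) ∉ vℓ.asIdeal := intCast_notMem_of_not_dvd hℓp hℓv hℓdK
  haveI hLO : w.asIdeal.LiesOver vℓ.asIdeal := liesOver_of_natCast_mem hℓp hℓv hwℓ
  have hgood : W.HasGoodReductionAtPrime ℓ := hasGoodReductionAtPrime_of_not_dvd_conductorNorm W hℓN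
  have hgoodv : W.HasGoodReductionAt vℓ := hasGoodReductionAt_of_hasGoodReductionAtPrime W hgood hℓv
  have hgoodK : (W.baseChange K).HasGoodReductionAt w := Engine.hasGoodReductionAt_baseChange_of_rat W hℓp hℓv hgoodv hwℓ
  have hf : w.asIdeal.inertiaDeg (𝓞 ℚ) = 2 :=
    Summit.BirchSwinnertonDyer.Rank1Residual.X11b.Three.Koly.Method2.LocalFrob.inertiaDeg_eq_two_of_isPrime_span K h2 hℓp hℓprime w hwℓ
  -- the regular Frobenius datum in the three consumer shapes
  have hfrob' : ∃ (v' : HeightOneSpectrum (𝓞 ℚ)) (𝔓' : Ideal (absIntegers (𝓞 ℚ) ℚ)) (h' : absoluteGaloisGroup ℚ),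
      (ℓ : 𝓞 ℚ) ∈ v'.asIdeal ∧ 𝔓' ∈ v'.primesAbove ∧ IsArithFrobAt (𝓞 ℚ) h' 𝔓' ∧
      (∀ P : geomTorsion W ((2 ^ (M + 2) : ℕ) : ℤ), h' • P = hfr • P) ∧
      ∀ (e : K →ₐ[ℚ] AlgebraicClosure ℚ) (z : K), h' • e z = c₀ • e z :=
    ⟨vP, 𝔓, hfr, hℓvP, h𝔓, hhfr, fun _ ↦ rfl, hhK⟩
  have h𝔓ℓ : 𝔓 ∈ vℓ.primesAbove := hvPℓ ▸ h𝔓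
  have hreg2 : ∃ (𝔓' : Ideal (absIntegers (𝓞 ℚ) ℚ)) (h' : absoluteGaloisGroup ℚ), 𝔓' ∈ vℓ.primesAbove ∧
      IsArithFrobAt (𝓞 ℚ) h' 𝔓' ∧ (∀ P : geomTorsion W ((2 : ℕ) : ℤ), h' • h' • P = P) ∧
      ∃ u : geomTorsion W ((2 : ℕ) : ℤ), h' • u ≠ u :=
    ⟨𝔓, hfr, h𝔓ℓ, hhfr, smul_smul_eq_self_of_dvd W (by exact_mod_cast dvd_pow_self 2 (Nat.succ_ne_zero (M + 1))) hhsq, hhu⟩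
  have hregM : ∃ (𝔓' : Ideal (absIntegers (𝓞 ℚ) ℚ)) (h' : absoluteGaloisGroup ℚ), 𝔓' ∈ vℓ.primesAbove ∧
      IsArithFrobAt (𝓞 ℚ) h' 𝔓' ∧ (∀ X : geomTorsion W ((2 ^ M : ℕ) : ℤ), h' • h' • X = X) ∧
      ∃ u : geomTorsion W 2, h' • u ≠ u :=
    ⟨𝔓, hfr, h𝔓ℓ, hhfr, smul_smul_eq_self_of_dvd W hdvd2 hhsq, exists_smul_ne_two_of_natCast W hhu⟩
  -- ### full local orders at `λ`, transferred back to level `2^M` (`Γ_{K_λ}` fixes `E[2^(M+2)]`)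
  obtain ⟨hαs', hαy'⟩ := hloc' w hwℓ
  have hmw : ((((2 ^ (M + 2) : ℕ) : ℕ) : ℤ) : 𝓞 K) ∉ w.asIdeal := fun hm ↦ by
    apply not_natCast_mem_of_prime_ne hℓp Nat.prime_two hℓ2 w hwℓ
    rw [Int.cast_natCast, Nat.cast_pow] at hm
    exact w.isPrime.mem_of_pow_mem _ hm
  haveI : NeZero (2 ^ (M + 2)) := ⟨pow_ne_zero _ two_ne_zero⟩
  have htriv : ∀ (g : absoluteGaloisGroup (w.adicCompletion K)) (Q : geomTorsion (W.baseChange K) ((2 ^ (M + 2) : ℕ) : ℤ)),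
      resGal (K := K) (w.adicCompletion K) g • Q = Q := fun g Q ↦
    Engine.absGaloisRestrict_smul_geomTorsion_eq_regular W hIQ hc₀ hhsq hℓp hℓprime hfrob' hwℓ hgoodK hmw g Q
  have htrans : ∀ x : galH1Torsion (W.baseChange K) ((2 ^ M : ℕ) : ℤ),
      x ∈ (W.baseChange K).torsionLocalKer (w.adicCompletion K) ((2 ^ M : ℕ) : ℤ) ↔
      ι₂ x ∈ (W.baseChange K).torsionLocalKer (w.adicCompletion K) ((2 ^ (M + 2) : ℕ) : ℤ) := fun x ↦
    mem_torsionLocalKer_iff_torsionH1OfDvd_mem (W.baseChange K) (w.adicCompletion K) (pow_dvd_pow 2 (by omega : M ≤ M + 2))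
      (pow_ne_zero _ two_ne_zero) (pow_ne_zero _ two_ne_zero) htriv x
  have hαs : ∀ j : ℕ, ((2 ^ j : ℕ) : ℤ) • s ∈ (W.baseChange K).torsionLocalKer (w.adicCompletion K) ((2 ^ M : ℕ) : ℤ) ↔ a ≤ j :=
    fun j ↦ by rw [htrans, map_zsmul]; exact hαs' j
  have hαy : ∀ j : ℕ, ((2 ^ j : ℕ) : ℤ) • y ∈ (W.baseChange K).torsionLocalKer (w.adicCompletion K) ((2 ^ M : ℕ) : ℤ) ↔ κ ≤ j :=
    fun j ↦ by rw [htrans, map_zsmul]; exact hαy' j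
  -- ### the datum at conductor `ℓ` compatible with `d₁`, its class `x = c_M(ℓ)` (sign `+1`) and Q2 at `λ`
  obtain ⟨dℓ, hdℓ⟩ := JET.exists_compatible_data_of_grossCM
    (phi_heegnerPointOfConductor_mem_range_map_ringClassField_holds (W.conductorNorm ℤ) W K) hIQ hD hHe 2 Dt β ι
    squarefree_one (by simp) d₁
  have hℓ1 : ℓ ∉ (1 : ℕ).primeFactors := by simp
  obtain ⟨hσ', hS', hS'', hemb'⟩ := hdℓ ℓ hkolZ hℓ1
  set d' := dℓ ℓ hkolZ hℓ1 with hd'_def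
  set x := d'.kolyvaginClass Nat.prime_two M with hx_def
  have hc' : Squarefree (1 * ℓ) := by rw [one_mul]; exact hℓp.squarefree
  have hℓn : ¬ ℓ ∣ 1 := fun h ↦ hℓp.one_lt.ne' (Nat.dvd_one.mp h)
  have hkM : ∀ q ∈ (1 * ℓ).primeFactors, Zhang2014.IsKolyvaginPrime (W.conductorNorm ℤ) W K 2 q ∧
      M ≤ Zhang2014.kolyvaginIndex W 2 q := by
    intro q hq
    rw [one_mul, hℓp.primeFactors, Finset.mem_singleton] at hq
    subst hq
    exact ⟨hkolZ, le_trans (by omega) hidx2⟩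
  have hkM1 : ∀ q ∈ (1 * ℓ).primeFactors, Zhang2014.IsKolyvaginPrime (W.conductorNorm ℤ) W K 2 q ∧
      M + 1 ≤ Zhang2014.kolyvaginIndex W 2 q := by
    intro q hq
    rw [one_mul, hℓp.primeFactors, Finset.mem_singleton] at hq
    subst hq
    exact ⟨hkolZ, le_trans (by omega) hidx2⟩
  have hkM2 : ∀ q ∈ (1 * ℓ).primeFactors, Zhang2014.IsKolyvaginPrime (W.conductorNorm ℤ) W K 2 q ∧
      M + 1 + 1 ≤ Zhang2014.kolyvaginIndex W 2 q := by
    intro q hq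
    rw [one_mul, hℓp.primeFactors, Finset.mem_singleton] at hq
    subst hq
    exact ⟨hkolZ, hidx2⟩
  have hcard : (1 * ℓ).primeFactors.card = 1 := by rw [one_mul, hℓp.primeFactors, Finset.card_singleton]
  -- signs: `c_M(ℓ)`, `c_{M+1}(ℓ)`, `c_{M+2}(ℓ)` are `τ`-invariant (`−w·(−1) = +1`)
  obtain ⟨-, hx⟩ := KolyvaginClassSign.sign_conjAct_kolyvaginClass_two hIQ h3 hD4 hodd hHe hsurj1 τ hτ Dt β ι hc' hM hkM d'
  obtain ⟨-, hx1⟩ := KolyvaginClassSign.sign_conjAct_kolyvaginClass_two hIQ h3 hD4 hodd hHe hsurj1 τ hτ Dt β ι hc' hM' hkM1 d'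
  obtain ⟨-, hx2⟩ := KolyvaginClassSign.sign_conjAct_kolyvaginClass_two hIQ h3 hD4 hodd hHe hsurj1 τ hτ Dt β ι hc' hM'' hkM2 d'
  rw [hcard, pow_one, hw1] at hx hx1 hx2
  norm_num at hx hx1 hx2
  -- Q2 at the own prime: Selmer threshold of `x` at `λ` = zero threshold `κ` of `y`
  have hQ := hQ2 W hcm K hIQ h3 hD4 hHe hρN Dt β ι M hM 1 ℓ hc' hℓp hℓn hkM d₁ d' hσ' hS' hS'' hemb' w hwℓ
  have hβ : ∀ j : ℕ, ((2 ^ j : ℕ) : ℤ) • x ∈ selmerLocalKer (W.baseChange K) (w.adicCompletion K) ((2 ^ M : ℕ) : ℤ) ↔ κ ≤ j :=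
    fun j ↦ (hQ j).1.trans (((hQ j).2).trans (hαy j))
  -- `ℓ` is away from every finite `v' ≠ v_ℓ`
  have haway : ∀ v' : HeightOneSpectrum (𝓞 ℚ), v' ≠ vℓ →
      ∀ w' : HeightOneSpectrum (𝓞 K), w'.asIdeal.LiesOver v'.asIdeal → ((1 * ℓ : ℕ) : 𝓞 K) ∉ w'.asIdeal := by
    intro v' hv' w' hw' hmem
    rw [one_mul] at hmem
    have hvmem : (ℓ : 𝓞 ℚ) ∈ v'.asIdeal := by
      have h : algebraMap (𝓞 ℚ) (𝓞 K) (ℓ : 𝓞 ℚ) ∈ w'.asIdeal := by rwa [map_natCast]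
      rw [← Ideal.mem_comap, ← Ideal.under_def, ← Ideal.LiesOver.over (P := w'.asIdeal) (p := v'.asIdeal)] at h
      exact h
    exact hv' ((natCast_prime_mem_iff_eq hℓp v').mp hvmem)
  -- ### the ℚ-descent `u` of `x` (margin one): Selmer at every finite `v' ≠ v_ℓ` and at `∞`; threshold `κ` at `v_ℓ`
  obtain ⟨u, hu, -⟩ := EigenClassesFinite.existsUnique_resTorsion_eq_of_conjAct_eq W K h2 hθ hd ((2 ^ M : ℕ) : ℤ) (htorsK M) hx
  have hudv : ((2 : ℤ) ^ (κ - 1)) • u ∉ selmerLocalKer W (vℓ.adicCompletion ℚ) ((2 ^ M : ℕ) : ℤ) := by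
    intro hmem
    have h' : ((2 : ℤ) ^ (κ - 1)) • resTorsion W K ((2 ^ M : ℕ) : ℤ) u ∈
        selmerLocalKer (W.baseChange K) (w.adicCompletion K) ((2 ^ M : ℕ) : ℤ) :=
      (SelmerDescent.zsmul_mem_selmerLocalKer_iff_resTorsion W h2 (not_mem_range hθ) hd ((2 ^ M : ℕ) : ℤ) vℓ w hgoodv hqv h2vℓ
        hdKv u _).mp hmem
    rw [hu] at h'
    have h'' : ((2 ^ (κ - 1) : ℕ) : ℤ) • x ∈ selmerLocalKer (W.baseChange K) (w.adicCompletion K) ((2 ^ M : ℕ) : ℤ) := by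
      exact_mod_cast h'
    have := (hβ (κ - 1)).mp h''
    omega
  -- ### THE DICHOTOMY: either `(ℓ, d')` is a witness — done — or `P(1·ℓ) = 2·Q` and we halve
  by_cases hwit : ∃ Q : (W.baseChange (ringClassField K ι (1 * ℓ))).toAffine.Point, (2 : ℤ) • Q = d'.derivedPoint
  swap
  · exact ⟨ℓ, d', hkolZ, hidx2, ⟨vP, 𝔓, hfr, c₀, hℓvP, h𝔓, hhfr, hc₀, hhsq, hhu, hhK⟩, hS', hemb', hwit⟩
  exfalso
  obtain ⟨Qh, hQh⟩ := hwit
  -- McCallum's standing inputs at level `M + 1` for `d'`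
  have hA1 : IsAdmissible (absoluteGaloisGroup K) d'.pointsSubgroup ((2 ^ (M + 1) : ℕ) : ℤ) :=
    isAdmissible_pointsSubgroup_two_of_heegner d' hIQ hc'.ne_zero hD4 hHe hρN (M + 1)
  have hP1 : d'.toGeomPoints d'.derivedPoint ∈ invPoints (absoluteGaloisGroup K) d'.pointsSubgroup ((2 ^ (M + 1) : ℕ) : ℤ) :=
    Prop44.toGeomPoints_derivedPoint_mem_invPoints hIQ ι hD hHe Dt Nat.prime_two hc' hkM1 d'
  -- the half-point class `x'`: `ι_M x' = c_{M+1}(ℓ)` (§2) and McCallum 4.6: `ι_M x = 2 • c_{M+1}(ℓ)`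
  obtain ⟨x', hx'⟩ : ∃ x' : galH1Torsion (W.baseChange K) ((2 ^ M : ℕ) : ℤ), ιM x' = d'.kolyvaginClass Nat.prime_two (M + 1) :=
    exists_torsionH1OfDvd_eq_kolyvaginClass_succ_of_two_zsmul_eq d' hA1 hP1 hQh
  have hlev : ιM x = (2 : ℤ) • d'.kolyvaginClass Nat.prime_two (M + 1) := by
    have h := torsionH1OfDvd_kolyvaginClass_pow d' Nat.prime_two (Nat.le_succ M) hA1 hP1
    rw [show M + 1 - M = 1 from by omega, pow_one] at h
    exact_mod_cast h
  have h2x' : (2 : ℤ) • x' = x := hιinj (by rw [map_zsmul, hx', ← hlev])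
  -- `τ`-invariance of `x'` (from that of `c_{M+1}(ℓ)`, `ι_M` injective)
  have hτx' : conjAct W τ ((2 ^ M : ℕ) : ℤ) x' = x' := by
    apply hιinj
    rw [hιM, ← conjAct_torsionH1OfDvd W τ hdvd x']
    change conjAct W τ ((2 ^ (M + 1) : ℕ) : ℤ) (ιM x') = ιM x'
    rw [hx', hx1]
  -- ### the ℚ-descents: `u1` of `c_{M+1}(ℓ)` and `u'` of `x'`; `ι_M u' = u1`, `2 • u' = u`
  obtain ⟨u1, hu1, -⟩ := EigenClassesFinite.existsUnique_resTorsion_eq_of_conjAct_eq W K h2 hθ hd ((2 ^ (M + 1) : ℕ) : ℤ)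
    (htorsK (M + 1)) hx1
  obtain ⟨u', hu', -⟩ := EigenClassesFinite.existsUnique_resTorsion_eq_of_conjAct_eq W K h2 hθ hd ((2 ^ M : ℕ) : ℤ) (htorsK M) hτx'
  have hιu' : torsionH1OfDvd W hdvd u' = u1 := by
    apply hinjres1
    rw [SelmerDescent.resTorsion_torsionH1OfDvd W K hdvd u', hu', hu1]
    exact hx'
  have h2u' : (2 : ℤ) • u' = u := hinjres (by rw [map_zsmul, hu', hu, h2x'])
  -- ### Selmer conditions of `u'` away from `ℓ` and at `∞` (margin one at level `M+1`, then level-invariance)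
  have hu'fin : ∀ v' : HeightOneSpectrum (𝓞 ℚ), v' ≠ vℓ → u' ∈ selmerLocalKer W (v'.adicCompletion ℚ) ((2 ^ M : ℕ) : ℤ) := by
    intro v' hv'
    obtain ⟨u1', hu1', hsel⟩ := SelmerDescent.exists_descent_kolyvaginClass_two_mem_selmerLocalKer_of_margin W hsurN hT K hIQ h2 hθ hd
      h3 hD4 hHe Dt β ι (M + 1) hc' hkM2 d' (htorsK (M + 1 + 1)) hx2 hx1 v' (haway v' hv')
    have huu : u1' = u1 := hinjres1 (hu1'.trans hu1.symm)
    rw [VisiblePairAtTwo.torsionH1OfDvd_mem_selmerLocalKer_iff W (v'.adicCompletion ℚ) hdvd u', hιu', ← huu]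
    exact hsel
  have hu'inf : ∀ w' : InfinitePlace ℚ, u' ∈ selmerLocalKer W w'.Completion ((2 ^ M : ℕ) : ℤ) := fun w' ↦ by
    rw [VisiblePairAtTwo.torsionH1OfDvd_mem_selmerLocalKer_iff W w'.Completion hdvd u', hιu']
    exact SelmerDescent.mem_selmerLocalKer_infinitePlace_of_resTorsion_eq_kolyvaginClass_two_of_margin W hsurN K hIQ h2 hθ hd h3
      hD4 hHe Dt β ι (M + 1) hc' hkM2 d' (htorsK (M + 1 + 1)) hx2 hu1 w'
  -- the Selmer threshold of `u'` at `v_ℓ` is `κ + 1`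
  have hu'dv : ((2 : ℤ) ^ κ) • u' ∉ selmerLocalKer W (vℓ.adicCompletion ℚ) ((2 ^ M : ℕ) : ℤ) := by
    have hk : ((2 : ℤ) ^ κ) • u' = ((2 : ℤ) ^ (κ - 1)) • u := by
      rw [← h2u', smul_smul, ← pow_succ, Nat.sub_add_cancel hκ1]
    rw [hk]
    exact hudv
  -- ### McCallum 5.3 + 2.2 over `ℚ_ℓ` at the REGULAR prime with the HALVED auxiliary: `2^(M − 1 − κ) • s₀` vanishes at `v_ℓ`
  have hdual := Engine.lemma_5_3_rat_two_regular W hM (q := 2 ^ M) rfl hℓ2 hℓv hgood hreg2 (le_trans (by omega) hidx2) hs₀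
    hu'fin hu'inf hu'dv
  -- transfer to `K_λ` by the REGULAR dictionary
  have hdualK : ((2 : ℤ) ^ (M - 1 - κ)) • s ∈ (W.baseChange K).torsionLocalKer (w.adicCompletion K) ((2 ^ M : ℕ) : ℤ) :=
    (Engine.zsmul_mem_torsionLocalKer_iff_resTorsion_of_notMem_regular W hM (q := 2 ^ M) rfl hℓp hℓ2 hℓv hgoodv h2
      (not_mem_range hθ) hd hdKv hregM w hf s₀ ((2 : ℤ) ^ (M - 1 - κ))).mp hdual
  have hdualK' : ((2 ^ (M - 1 - κ) : ℕ) : ℤ) • s ∈ (W.baseChange K).torsionLocalKer (w.adicCompletion K) ((2 ^ M : ℕ) : ℤ) := by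
    exact_mod_cast hdualK
  -- ### conclusion: `a ≤ M − 1 − κ ≤ M₀ − 1`, contradicting `2^{M₀−1} • s₀ ≠ 0`
  have haMκ : a ≤ M - 1 - κ := (hαs (M - 1 - κ)).mp hdualK'
  have haM₀ : a ≤ M₀ - 1 := by omega
  have hs0 : ((2 ^ (M₀ - 1) : ℕ) : ℤ) • s = 0 := (two_pow_zsmul_eq_zero_iff_of_addOrderOf W K ha (M₀ - 1)).mpr haM₀
  exact hne (hinjres (by rw [map_zsmul, map_zero, ← hsdef, hs0]))

end Summit.BirchSwinnertonDyer.BirchSwinnertonDyer.Theorems.GenusExact.PlusDescent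

end
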